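import Summits.MatrixMultiplication.MatrixMultiplication.Theorems.SoloInformedValLabelPacking

/-!
# One-shot packing schemes: `K_{2,2}` without (Q2), and the hexagon (solo-informed gen 87, CLAIMS c665)

Continuation of `SoloInformedValLabelPacking` / `SoloInformedValGridK22` (dossier §15.8 (n)(xxv), `work/g87/cyc/CYC.md` §8).
A ONE-SHOT PACKING SCHEME for an aligned grid pattern assigns to every cell `t` one translate of its label set — either the
`z`-translate `L_t + (λ_t + μ_t)` or a shifted `y`-translate `L_t + (μ_t + λ_{b(t)})` — such that all assigned translates are
pairwise disjoint by one of the label conditions that SURVIVE the alignments ((Z) across columns, (Y) across rows, and the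
non-escaping (P5) triples).  Such a scheme proves `Σ_t |L_t| ≤ |Λ|` — the (PT) budget `T ≤ n` for the pattern — in one
stroke and WITHOUT the within-block condition (Q2).  `packscheme.py` finds schemes for exactly three of the patterns examined;
two are checked here (the third, the L-shape, is a sub-pattern of both).

* `sum_card_le_of_K22_packing` — `K_{2,2}` (`p q / r s`): `{L_p^z, L_s^z, L_q^y + λ_r, L_r^y + λ_q}`; six conditions.
* `sum_card_le_of_hexagon_packing` — the hexagon (cells `a=00, b=01, c=11, d=12, e=22, f=20` of a `3 × 3` grid, the
  2-regular row/column sharing pattern): `{L_a^z, L_b^y+λ_c, L_c^y+λ_a, L_d^y+λ_c, L_e^z, L_f^y+λ_c}`; fifteen conditions.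
-/

namespace Summit.MatrixMultiplication.MatrixMultiplication.Theorems.SoloVal

open Finset

section GridPackings

variable {G : Type*} [AddCommGroup G] [DecidableEq G]

/-- `K_{2,2}` ONE-SHOT PACKING (no (Q2) needed).  Grid `p q / r s`: rows `{p,q}`, `{r,s}`, columns `{p,r}`, `{q,s}`.
Hypotheses: (Z)(p,s), (Z)(q,r) (diagonal pairs lie in different columns) and the four non-escaping triples (P5)(q,p,r),
(P5)(r,p,q), (P5)(q,s,r), (P5)(r,s,q).  Conclusion `|L_p|+|L_q|+|L_r|+|L_s| ≤ |Λ|`. -/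
theorem sum_card_le_of_K22_packing [Fintype G] (h2 : ∀ g : G, g + g = 0) (Lp Lq Lr Ls : Finset G)
    (lp lq lr ls mp mq mr ms : G)
    (hZps : ∀ ℓ ∈ Lp, ∀ ℓ' ∈ Ls, ℓ + ℓ' ≠ lp + mp + ls + ms)
    (hZqr : ∀ ℓ ∈ Lq, ∀ ℓ' ∈ Lr, ℓ + ℓ' ≠ lq + mq + lr + mr)
    (hP5qpr : ∀ ℓ ∈ Lq, ∀ ℓ' ∈ Lp, ℓ + ℓ' ≠ mq + lp + mp + lr)
    (hP5rpq : ∀ ℓ ∈ Lr, ∀ ℓ' ∈ Lp, ℓ + ℓ' ≠ mr + lp + mp + lq)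
    (hP5qsr : ∀ ℓ ∈ Lq, ∀ ℓ' ∈ Ls, ℓ + ℓ' ≠ mq + ls + ms + lr)
    (hP5rsq : ∀ ℓ ∈ Lr, ∀ ℓ' ∈ Ls, ℓ + ℓ' ≠ mr + ls + ms + lq) :
    Lp.card + Lq.card + Lr.card + Ls.card ≤ Fintype.card G := by
  classical
  set P := labelShift Lp (lp + mp) with hP
  set S := labelShift Ls (ls + ms) with hS
  set Q := labelShift Lq (mq + lr) with hQ
  set R := labelShift Lr (mr + lq) with hR
  have dPS : Disjoint P S := disjoint_labelShift h2 (fun ℓ hℓ ℓ' hℓ' h =>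
    hZps ℓ hℓ ℓ' hℓ' (by rw [h]; try abel))
  have dPQ : Disjoint P Q := disjoint_labelShift h2 (fun ℓ hℓ ℓ' hℓ' h =>
    hP5qpr ℓ' hℓ' ℓ hℓ (by rw [add_comm ℓ' ℓ, h]; try abel))
  have dPR : Disjoint P R := disjoint_labelShift h2 (fun ℓ hℓ ℓ' hℓ' h =>
    hP5rpq ℓ' hℓ' ℓ hℓ (by rw [add_comm ℓ' ℓ, h]; try abel))
  have dSQ : Disjoint S Q := disjoint_labelShift h2 (fun ℓ hℓ ℓ' hℓ' h =>
    hP5qsr ℓ' hℓ' ℓ hℓ (by rw [add_comm ℓ' ℓ, h]; try abel))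
  have dSR : Disjoint S R := disjoint_labelShift h2 (fun ℓ hℓ ℓ' hℓ' h =>
    hP5rsq ℓ' hℓ' ℓ hℓ (by rw [add_comm ℓ' ℓ, h]; try abel))
  have dQR : Disjoint Q R := disjoint_labelShift h2 (fun ℓ hℓ ℓ' hℓ' h =>
    hZqr ℓ hℓ ℓ' hℓ' (by rw [h]; try abel))
  have c1 : (P ∪ S).card = Lp.card + Ls.card := by
    rw [card_union_of_disjoint dPS, card_labelShift, card_labelShift]
  have c2 : (Q ∪ R).card = Lq.card + Lr.card := by
    rw [card_union_of_disjoint dQR, card_labelShift, card_labelShift]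
  have d12 : Disjoint (P ∪ S) (Q ∪ R) :=
    disjoint_union_left.2 ⟨disjoint_union_right.2 ⟨dPQ, dPR⟩, disjoint_union_right.2 ⟨dSQ, dSR⟩⟩
  calc Lp.card + Lq.card + Lr.card + Ls.card = ((P ∪ S) ∪ (Q ∪ R)).card := by
        rw [card_union_of_disjoint d12, c1, c2]; ring
    _ ≤ Fintype.card G := card_le_univ _

/-- HEXAGON ONE-SHOT PACKING.  Cells `a=(0,0), b=(0,1), c=(1,1), d=(1,2), e=(2,2), f=(2,0)`; translates `A = L_a + (λ_a+μ_a)`,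
`B = L_b + (μ_b+λ_c)`, `C = L_c + (μ_c+λ_a)`, `D = L_d + (μ_d+λ_c)`, `E = L_e + (λ_e+μ_e)`, `F = L_f + (μ_f+λ_c)`.  The fifteen
hypotheses are the surviving conditions that make them pairwise disjoint: (Z)(a,e); (Y)(a,c), (Y)(b,d), (Y)(b,f), (Y)(d,f); and
the non-escaping triples (P5)(b,a,c), (P5)(d,a,c), (P5)(f,a,c), (P5)(b,e,c), (P5)(c,e,a), (P5)(d,e,c), (P5)(f,e,c), (P5)(b,c,a),
(P5)(d,c,a), (P5)(f,c,a).  Conclusion `Σ_t |L_t| ≤ |Λ|` for the hexagon pattern. -/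
theorem sum_card_le_of_hexagon_packing [Fintype G] (h2 : ∀ g : G, g + g = 0) (La Lb Lc Ld Le Lf : Finset G)
    (la lc le ma mb mc md me mf : G)
    (hZae : ∀ ℓ ∈ La, ∀ ℓ' ∈ Le, ℓ + ℓ' ≠ la + ma + le + me)
    (hYac : ∀ ℓ ∈ La, ∀ ℓ' ∈ Lc, ℓ + ℓ' ≠ ma + mc)
    (hYbd : ∀ ℓ ∈ Lb, ∀ ℓ' ∈ Ld, ℓ + ℓ' ≠ mb + md)
    (hYbf : ∀ ℓ ∈ Lb, ∀ ℓ' ∈ Lf, ℓ + ℓ' ≠ mb + mf)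
    (hYdf : ∀ ℓ ∈ Ld, ∀ ℓ' ∈ Lf, ℓ + ℓ' ≠ md + mf)
    (hP5bac : ∀ ℓ ∈ Lb, ∀ ℓ' ∈ La, ℓ + ℓ' ≠ mb + la + ma + lc)
    (hP5dac : ∀ ℓ ∈ Ld, ∀ ℓ' ∈ La, ℓ + ℓ' ≠ md + la + ma + lc)
    (hP5fac : ∀ ℓ ∈ Lf, ∀ ℓ' ∈ La, ℓ + ℓ' ≠ mf + la + ma + lc)
    (hP5bec : ∀ ℓ ∈ Lb, ∀ ℓ' ∈ Le, ℓ + ℓ' ≠ mb + le + me + lc)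
    (hP5cea : ∀ ℓ ∈ Lc, ∀ ℓ' ∈ Le, ℓ + ℓ' ≠ mc + le + me + la)
    (hP5dec : ∀ ℓ ∈ Ld, ∀ ℓ' ∈ Le, ℓ + ℓ' ≠ md + le + me + lc)
    (hP5fec : ∀ ℓ ∈ Lf, ∀ ℓ' ∈ Le, ℓ + ℓ' ≠ mf + le + me + lc)
    (hP5bca : ∀ ℓ ∈ Lb, ∀ ℓ' ∈ Lc, ℓ + ℓ' ≠ mb + lc + mc + la)
    (hP5dca : ∀ ℓ ∈ Ld, ∀ ℓ' ∈ Lc, ℓ + ℓ' ≠ md + lc + mc + la)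
    (hP5fca : ∀ ℓ ∈ Lf, ∀ ℓ' ∈ Lc, ℓ + ℓ' ≠ mf + lc + mc + la) :
    La.card + Lb.card + Lc.card + Ld.card + Le.card + Lf.card ≤ Fintype.card G := by
  classical
  have dd : ∀ (x y d : G), x = y + (d + d) → x = y := fun x y d h => by rw [h, h2, add_zero]
  set A := labelShift La (la + ma) with hA
  set B := labelShift Lb (mb + lc) with hB
  set C := labelShift Lc (mc + la) with hC
  set D := labelShift Ld (md + lc) with hD
  set E := labelShift Le (le + me) with hE
  set F := labelShift Lf (mf + lc) with hF
  have dAE : Disjoint A E := disjoint_labelShift h2 (fun ℓ hℓ ℓ' hℓ' h =>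
    hZae ℓ hℓ ℓ' hℓ' (by rw [h]; try abel))
  have dAB : Disjoint A B := disjoint_labelShift h2 (fun ℓ hℓ ℓ' hℓ' h =>
    hP5bac ℓ' hℓ' ℓ hℓ (by rw [add_comm ℓ' ℓ, h]; try abel))
  have dAC : Disjoint A C := disjoint_labelShift h2 (fun ℓ hℓ ℓ' hℓ' h =>
    hYac ℓ hℓ ℓ' hℓ' (dd _ _ la (by rw [h]; try abel)))
  have dAD : Disjoint A D := disjoint_labelShift h2 (fun ℓ hℓ ℓ' hℓ' h =>
    hP5dac ℓ' hℓ' ℓ hℓ (by rw [add_comm ℓ' ℓ, h]; try abel))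
  have dAF : Disjoint A F := disjoint_labelShift h2 (fun ℓ hℓ ℓ' hℓ' h =>
    hP5fac ℓ' hℓ' ℓ hℓ (by rw [add_comm ℓ' ℓ, h]; try abel))
  have dEB : Disjoint E B := disjoint_labelShift h2 (fun ℓ hℓ ℓ' hℓ' h =>
    hP5bec ℓ' hℓ' ℓ hℓ (by rw [add_comm ℓ' ℓ, h]; try abel))
  have dEC : Disjoint E C := disjoint_labelShift h2 (fun ℓ hℓ ℓ' hℓ' h =>
    hP5cea ℓ' hℓ' ℓ hℓ (by rw [add_comm ℓ' ℓ, h]; try abel))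
  have dED : Disjoint E D := disjoint_labelShift h2 (fun ℓ hℓ ℓ' hℓ' h =>
    hP5dec ℓ' hℓ' ℓ hℓ (by rw [add_comm ℓ' ℓ, h]; try abel))
  have dEF : Disjoint E F := disjoint_labelShift h2 (fun ℓ hℓ ℓ' hℓ' h =>
    hP5fec ℓ' hℓ' ℓ hℓ (by rw [add_comm ℓ' ℓ, h]; try abel))
  have dBC : Disjoint B C := disjoint_labelShift h2 (fun ℓ hℓ ℓ' hℓ' h =>
    hP5bca ℓ hℓ ℓ' hℓ' (by rw [h]; try abel))
  have dBD : Disjoint B D := disjoint_labelShift h2 (fun ℓ hℓ ℓ' hℓ' h =>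
    hYbd ℓ hℓ ℓ' hℓ' (dd _ _ lc (by rw [h]; try abel)))
  have dBF : Disjoint B F := disjoint_labelShift h2 (fun ℓ hℓ ℓ' hℓ' h =>
    hYbf ℓ hℓ ℓ' hℓ' (dd _ _ lc (by rw [h]; try abel)))
  have dCD : Disjoint C D := disjoint_labelShift h2 (fun ℓ hℓ ℓ' hℓ' h =>
    hP5dca ℓ' hℓ' ℓ hℓ (by rw [add_comm ℓ' ℓ, h]; try abel))
  have dCF : Disjoint C F := disjoint_labelShift h2 (fun ℓ hℓ ℓ' hℓ' h =>
    hP5fca ℓ' hℓ' ℓ hℓ (by rw [add_comm ℓ' ℓ, h]; try abel))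
  have dDF : Disjoint D F := disjoint_labelShift h2 (fun ℓ hℓ ℓ' hℓ' h =>
    hYdf ℓ hℓ ℓ' hℓ' (dd _ _ lc (by rw [h]; try abel)))
  -- count: (A ∪ E) ∪ (B ∪ D) ∪ (C ∪ F)
  have c1 : (A ∪ E).card = La.card + Le.card := by
    rw [card_union_of_disjoint dAE, card_labelShift, card_labelShift]
  have c2 : (B ∪ D).card = Lb.card + Ld.card := by
    rw [card_union_of_disjoint dBD, card_labelShift, card_labelShift]
  have c3 : (C ∪ F).card = Lc.card + Lf.card := by
    rw [card_union_of_disjoint dCF, card_labelShift, card_labelShift]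
  have d12 : Disjoint (A ∪ E) (B ∪ D) :=
    disjoint_union_left.2 ⟨disjoint_union_right.2 ⟨dAB, dAD⟩, disjoint_union_right.2 ⟨dEB, dED⟩⟩
  have c12 : ((A ∪ E) ∪ (B ∪ D)).card = La.card + Le.card + (Lb.card + Ld.card) := by
    rw [card_union_of_disjoint d12, c1, c2]
  have d123 : Disjoint ((A ∪ E) ∪ (B ∪ D)) (C ∪ F) :=
    disjoint_union_left.2 ⟨disjoint_union_left.2 ⟨disjoint_union_right.2 ⟨dAC, dAF⟩,
      disjoint_union_right.2 ⟨dEC, dEF⟩⟩, disjoint_union_left.2 ⟨disjoint_union_right.2 ⟨dBC, dBF⟩,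
      disjoint_union_right.2 ⟨dCD.symm, dDF⟩⟩⟩
  calc La.card + Lb.card + Lc.card + Ld.card + Le.card + Lf.card = (((A ∪ E) ∪ (B ∪ D)) ∪ (C ∪ F)).card := by
        rw [card_union_of_disjoint d123, c12, c3]; ring
    _ ≤ Fintype.card G := card_le_univ _

end GridPackings

end Summit.MatrixMultiplication.MatrixMultiplication.Theorems.SoloVal
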